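import Summits.QuantumFields.YangMills.Theorems.IR.SCFloorSlopeLawEstimate

/-!
# Strong-coupling floor engine, part 22: the volume-uniform `4/b` law for the β-slope of the facing-plaquette correlator

Pooled prover `ym-ir-line-bsf-p1` (LEAD of line `beta-slope-floor`, crux `IR`, stmt-QuantumFields-19354).  The line's
strong-coupling rung `BetaSlopeFloor.stub_rung_strongCoupling` (p594987) is POINTWISE in the torus: for each `(A, S, n)`
some `K, β_sc` with `(2n/b − K)·D_b ≤ ∂_b D_b` on `(0, β_sc]`; the volume-uniform form is the census row «tube
re-expansion».  This file settles the instance `n = 1`, `A =` plaquette, UNIFORMLY IN THE VOLUME and with the sharp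
coefficient `4` (the lightest strong-coupling state between facing plaquettes is the tube of four lateral plaquettes):
there are `β₀ > 0`, `K ≥ 0` depending only on `ρ` such that on every torus `(ℤ/L)⁴`, `L ≥ 3`, and for every
`0 < b ≤ β₀`, `D_L(b) := latticeConnectedCorr ρ b L P P 1 > 0` and

  `(4/b − K)·D_L(b) ≤ ∂_b D_L(b) ≤ (4/b + K)·D_L(b)`        (`facingPlaquetteCorr_logSlope`),

i.e. `|∂_b log D_L(b) − 4/b| ≤ K` uniformly in `L` — from part 21 (`cov_facing_deriv_estimate`:
`D_L = Jb⁴ + O(b⁵)`, `∂_b D_L = 4Jb³ + O(b⁴)` with volume-independent constants, `J = φ^{*6}(1) > 0` by parts 1–2)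
and the elementary `slope_law_of_estimates`.  In the binders of the `IR` lines: `facingPlaquetteCorr_logSlope_latticeRep`;
in the currency of the line's rung (odd tori `(2S+1)⁴`, slope floor `(2n/b − K)·D ≤ ∂_b D` at `n = 1`, `K, β_sc`
uniform in `S`): `rung_strongCoupling_uniform_plaquette_one`.
HONEST: strong coupling only, group-blind (any compact `G`, any continuous matrix `ρ` with `Re tr ρ` non-constant);
nothing here bears on `BalabanLadder.IR` at weak coupling, on the line's XL loads `stub_reflSlopeFloor` /
`stub_windowRegularity`, or on the Clay Yang–Mills mass gap (R4 closes only the conditional finite-𝕋⁴ rung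
`BalabanLadder.UV`).
-/

set_option autoImplicit false

noncomputable section

open MeasureTheory Filter Topology Function
open Literature.MathematicalPhysics.QuantumFieldTheory
open Literature.MathematicalPhysics.QuantumLattice (haarConv plaquetteObs IsSimpleCompactGroup)

namespace Summit.QuantumFields.YangMills.Cruxes.IR.SCFloor

/-! ## §3 The `4/b` law -/

/-- From `|D − J b⁴| ≤ K₁ b⁵`, `|D' − 4 J b³| ≤ K₂ b⁴`, `J > 0` and `b ≤ J/(2(K₁+1))`: `D ≥ (J/2) b⁴ > 0` and
`(4/b − K)·D ≤ D' ≤ (4/b + K)·D` with `K = 2(K₂ + 4K₁)/J`. (Elementary.) -/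
theorem slope_law_of_estimates {D D' J K₁ K₂ b : ℝ} (hJ : 0 < J) (hK₁ : 0 ≤ K₁) (hK₂ : 0 ≤ K₂) (hb : 0 < b)
    (hbJ : b ≤ J / (2 * (K₁ + 1))) (hE : |D - J * b ^ 4| ≤ K₁ * b ^ 5) (hE' : |D' - 4 * J * b ^ 3| ≤ K₂ * b ^ 4) :
    J / 2 * b ^ 4 ≤ D ∧ (4 / b - 2 * (K₂ + 4 * K₁) / J) * D ≤ D' ∧ D' ≤ (4 / b + 2 * (K₂ + 4 * K₁) / J) * D := by
  set Kc : ℝ := 2 * (K₂ + 4 * K₁) / J with hKc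
  obtain ⟨hE1, hE2⟩ := abs_le.1 hE
  obtain ⟨hE3, hE4⟩ := abs_le.1 hE'
  have hb4 : 0 < b ^ 4 := by positivity
  have hb5 : b ^ 5 = b ^ 4 * b := by ring
  rw [hb5] at hE1 hE2
  -- `K₁ b ≤ J/2`, hence `D ≥ (J/2) b⁴`
  have hK₁b : K₁ * b ≤ J / 2 := by
    have h1 : K₁ * b ≤ K₁ * (J / (2 * (K₁ + 1))) := mul_le_mul_of_nonneg_left hbJ hK₁
    have h2 : K₁ * (J / (2 * (K₁ + 1))) ≤ J / 2 := by
      rw [mul_div_assoc', div_le_div_iff₀ (by positivity) (by positivity)]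
      nlinarith
    exact h1.trans h2
  have hK₁b4 : K₁ * b * b ^ 4 ≤ J / 2 * b ^ 4 := mul_le_mul_of_nonneg_right hK₁b hb4.le
  have hD : J / 2 * b ^ 4 ≤ D := by nlinarith
  have hDpos : 0 < D := lt_of_lt_of_le (by positivity) hD
  -- `Kc·D ≥ (K₂ + 4K₁) b⁴`
  have hKcD : (K₂ + 4 * K₁) * b ^ 4 ≤ Kc * D := by
    have h3 : Kc * (J / 2 * b ^ 4) ≤ Kc * D := mul_le_mul_of_nonneg_left hD (by positivity)
    have h4 : Kc * (J / 2 * b ^ 4) = (K₂ + 4 * K₁) * b ^ 4 := by rw [hKc]; field_simp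
    linarith
  have h1 := mul_le_mul_of_nonneg_right hE3 hb.le
  have h2 := mul_le_mul_of_nonneg_right hE4 hb.le
  have h3 := mul_le_mul_of_nonneg_right hKcD hb.le
  have hlo' : 4 * D - Kc * D * b ≤ D' * b := by nlinarith
  have hhi' : D' * b ≤ 4 * D + Kc * D * b := by nlinarith
  have e1 : (4 / b - Kc) * D = (4 * D - Kc * D * b) / b := by field_simp
  have e2 : (4 / b + Kc) * D = (4 * D + Kc * D * b) / b := by field_simp
  refine ⟨hD, ?_, ?_⟩
  · rw [e1, div_le_iff₀ hb]; exact hlo'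
  · rw [e2, le_div_iff₀ hb]; exact hhi'

variable {G : Type} [Group G] [TopologicalSpace G] [IsTopologicalGroup G] [CompactSpace G] [MeasurableSpace G]
  [BorelSpace G] [SecondCountableTopology G] [T2Space G] {N : ℕ} (ρ : G →* Matrix (Fin N) (Fin N) ℂ)

/-- **The volume-uniform `4/b` law for the β-slope of the facing-plaquette correlator (strong coupling).**  For a
continuous matrix representation `ρ` of a compact group with `Re tr ρ` non-constant there are `β₀ > 0` and `K ≥ 0`
such that on EVERY torus `(ℤ/L)⁴`, `L ≥ 3`, and for every `0 < b ≤ β₀`, the connected correlator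
`D_L(b) = latticeConnectedCorr ρ b L P P 1` of the facing plaquettes `P = Re tr ρ(U_{(0;1,2)})` is positive and its
β-derivative obeys `(4/b − K)·D_L(b) ≤ ∂_b D_L(b) ≤ (4/b + K)·D_L(b)`, i.e. `|∂_b log D_L − 4/b| ≤ K` uniformly in
the volume (the tube of four lateral plaquettes is the lightest strong-coupling state between facing plaquettes). -/
theorem facingPlaquetteCorr_logSlope (hρ : Continuous ρ) (hnc : ∃ g h : G, (ρ g).trace.re ≠ (ρ h).trace.re) :
    ∃ β₀ K : ℝ, 0 < β₀ ∧ 0 ≤ K ∧ ∀ (L : ℕ) [NeZero L], 3 ≤ L → ∀ b : ℝ, 0 < b → b ≤ β₀ →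
      0 < latticeConnectedCorr ρ b L (plaquetteObs ρ 0 1 2) (plaquetteObs ρ 0 1 2) 1 ∧
      (4 / b - K) * latticeConnectedCorr ρ b L (plaquetteObs ρ 0 1 2) (plaquetteObs ρ 0 1 2) 1 ≤
          deriv (fun b' => latticeConnectedCorr ρ b' L (plaquetteObs ρ 0 1 2) (plaquetteObs ρ 0 1 2) 1) b ∧
        deriv (fun b' => latticeConnectedCorr ρ b' L (plaquetteObs ρ 0 1 2) (plaquetteObs ρ 0 1 2) 1) b ≤
          (4 / b + K) * latticeConnectedCorr ρ b L (plaquetteObs ρ 0 1 2) (plaquetteObs ρ 0 1 2) 1 := by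
  set m₀ : ℝ := ∫ h, (ρ h).trace.re ∂haarProbability G with hm₀
  set φ : G → ℝ := fun g => (ρ g).trace.re - m₀ with hφ
  set J : ℝ := ((haarConv φ)^[5] φ) 1 with hJ
  -- `J > 0`
  have hφc : Continuous φ := (continuous_trace_re ρ hρ).sub continuous_const
  have hφs : ∀ g, φ g⁻¹ = φ g := fun g => by
    simp only [hφ, Literature.RepresentationTheory.CompactGroups.CompactGroup.re_trace_map_inv ρ hρ]
  have hφ0 : φ ≠ 0 := by
    obtain ⟨g, h, hgh⟩ := hnc
    intro hz
    have h1 := congrFun hz g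
    have h2 := congrFun hz h
    simp only [hφ, Pi.zero_apply, sub_eq_zero] at h1 h2
    exact hgh (h1.trans h2.symm)
  have hJpos : 0 < J := convIter_five_apply_one_pos hφc hφs hφ0
  obtain ⟨K₁, K₂, b₀, hb₀, hK₁, hK₂, hest⟩ := cov_facing_deriv_estimate ρ hρ
  refine ⟨min b₀ (J / (2 * (K₁ + 1))), 2 * (K₂ + 4 * K₁) / J, by positivity, by positivity,
    fun L _ hL b hb0 hb => ?_⟩
  obtain ⟨hE, D', hD', hE'⟩ := hest L hL b hb0 (hb.trans (min_le_left _ _))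
  obtain ⟨hD, hlo, hhi⟩ := slope_law_of_estimates hJpos hK₁ hK₂ hb0 (hb.trans (min_le_right _ _)) hE hE'
  rw [hD'.deriv]
  exact ⟨lt_of_lt_of_le (by positivity) hD, hlo, hhi⟩

/-! ## §4 In the binders of the `IR` lines, and in the currency of the line's strong-coupling rung -/

/-- **The `4/b` law in the binders of the `IR` lines.**  For every compact simple Lie group `G` (Borel σ-algebra) and
every `r : LatticeRep G`: `∃ β₀ > 0, K ≥ 0`, on every torus `(ℤ/L)⁴`, `L ≥ 3`, for all `0 < b ≤ β₀`,
`D_L(b) > 0` and `(4/b − K)·D_L(b) ≤ ∂_b D_L(b) ≤ (4/b + K)·D_L(b)`, `D_L(b) = latticeConnectedCorr r.ρ b L P P 1`,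
`P = plaquetteObs r.ρ 0 1 2`. -/
theorem facingPlaquetteCorr_logSlope_latticeRep :
    ∀ (G : Type) [Group G] [TopologicalSpace G] [IsTopologicalGroup G] [CompactSpace G],
      IsCompactSimpleLieGroup G →
      letI := borel G; haveI : BorelSpace G := ⟨rfl⟩;
      ∀ (r : LatticeRep G), ∃ β₀ K : ℝ, 0 < β₀ ∧ 0 ≤ K ∧
        ∀ (L : ℕ) [NeZero L], 3 ≤ L → ∀ b : ℝ, 0 < b → b ≤ β₀ →
          0 < latticeConnectedCorr r.ρ b L (plaquetteObs r.ρ 0 1 2) (plaquetteObs r.ρ 0 1 2) 1 ∧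
          (4 / b - K) * latticeConnectedCorr r.ρ b L (plaquetteObs r.ρ 0 1 2) (plaquetteObs r.ρ 0 1 2) 1 ≤
              deriv (fun b' => latticeConnectedCorr r.ρ b' L (plaquetteObs r.ρ 0 1 2) (plaquetteObs r.ρ 0 1 2) 1) b ∧
            deriv (fun b' => latticeConnectedCorr r.ρ b' L (plaquetteObs r.ρ 0 1 2) (plaquetteObs r.ρ 0 1 2) 1) b ≤
              (4 / b + K) * latticeConnectedCorr r.ρ b L (plaquetteObs r.ρ 0 1 2) (plaquetteObs r.ρ 0 1 2) 1 := by
  intro G _ _ _ _ hG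
  letI : MeasurableSpace G := borel G
  haveI : BorelSpace G := ⟨rfl⟩
  intro r
  have hemb : IsClosedEmbedding r.ρ := r.continuous.isClosedEmbedding r.injective
  haveI : T2Space G := hemb.isEmbedding.t2Space
  haveI : SecondCountableTopology G := hemb.isEmbedding.secondCountableTopology
  exact facingPlaquetteCorr_logSlope r.ρ r.continuous (latticeRep_re_trace_nonconst hG.1.2.1 r)

/-- **The line's strong-coupling rung at `n = 1` for the plaquette, UNIFORMLY IN THE VOLUME** (the registered rung
`BetaSlopeFloor.stub_rung_strongCoupling`, p594987, has `K, β_sc` depending on the torus; here they depend only on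
`(G, r)`): for every compact simple Lie `G` and `r : LatticeRep G` there are `K` and `β_sc > 0` with
`(2·1/b − K)·D_b ≤ ∂_b D_b` for all odd tori `(2S+1)⁴`, `S ≥ 1`, and all `0 < b ≤ β_sc`, where
`D_b = latticeConnectedCorr r.ρ b (2S+1) P P 1` is the line's `diagCorr r b S A 1` for the plaquette species
(`A.F = plaquetteObs r.ρ 0 1 2`, a time-zero slice species).  Indeed `(4/b − K)·D ≤ ∂_b D` and `D ≥ 0`. -/
theorem rung_strongCoupling_uniform_plaquette_one :
    ∀ (G : Type) [Group G] [TopologicalSpace G] [IsTopologicalGroup G] [CompactSpace G],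
      IsCompactSimpleLieGroup G →
      letI := borel G; haveI : BorelSpace G := ⟨rfl⟩;
      ∀ (r : LatticeRep G), ∃ K βsc : ℝ, 0 < βsc ∧ ∀ S : ℕ, 1 ≤ S → ∀ b : ℝ, 0 < b → b ≤ βsc →
        (2 * (1 : ℕ) / b - K) *
            latticeConnectedCorr r.ρ b (2 * S + 1) (plaquetteObs r.ρ 0 1 2) (plaquetteObs r.ρ 0 1 2) 1 ≤
          deriv (fun b' =>
            latticeConnectedCorr r.ρ b' (2 * S + 1) (plaquetteObs r.ρ 0 1 2) (plaquetteObs r.ρ 0 1 2) 1) b := by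
  intro G _ _ _ _ hG
  letI : MeasurableSpace G := borel G
  haveI : BorelSpace G := ⟨rfl⟩
  intro r
  obtain ⟨β₀, K, hβ₀, hK, h⟩ := facingPlaquetteCorr_logSlope_latticeRep G hG r
  refine ⟨K, β₀, hβ₀, fun S hS b hb0 hb => ?_⟩
  obtain ⟨hpos, hlo, -⟩ := h (2 * S + 1) (by omega) b hb0 hb
  have h2 : (2 * (1 : ℕ) / b - K) ≤ (4 / b - K) := by
    have : (2 * (1 : ℕ) / b : ℝ) ≤ 4 / b := by
      rw [Nat.cast_one, mul_one]; exact div_le_div_of_nonneg_right (by norm_num) hb0.le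
    linarith
  exact (mul_le_mul_of_nonneg_right h2 hpos.le).trans hlo

/-! ## §5 Integrated form: two-sided strong-coupling window domination at `n = 1`, uniformly in the volume -/

/-- **Two-sided strong-coupling window domination at `n = 1` (the integrated `4/b` law), UNIFORMLY IN THE VOLUME.**
For a continuous matrix representation `ρ` of a compact group with `Re tr ρ` non-constant there are `β₀ > 0`, `K ≥ 0`
such that on every torus `(ℤ/L)⁴`, `L ≥ 3`, and for all `0 < b ≤ b' ≤ β₀`:
`(b'/b)⁴·e^{−K(b'−b)}·D_L(b) ≤ D_L(b') ≤ (b'/b)⁴·e^{K(b'−b)}·D_L(b)`, `D_L(b) = latticeConnectedCorr ρ b L P P 1`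
(mean value theorem for `log D_L − 4 log b`, whose derivative lies in `[−K, K]` by the slope law).  This is the
strong-coupling, `n = 1` instance of the line's INTEGRATED typing (window domination, card option (S-c)) with
constants independent of the torus. -/
theorem facingPlaquetteCorr_window (hρ : Continuous ρ) (hnc : ∃ g h : G, (ρ g).trace.re ≠ (ρ h).trace.re) :
    ∃ β₀ K : ℝ, 0 < β₀ ∧ 0 ≤ K ∧ ∀ (L : ℕ) [NeZero L], 3 ≤ L → ∀ b b' : ℝ, 0 < b → b ≤ b' → b' ≤ β₀ →
      (b' / b) ^ 4 * Real.exp (-(K * (b' - b))) *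
            latticeConnectedCorr ρ b L (plaquetteObs ρ 0 1 2) (plaquetteObs ρ 0 1 2) 1 ≤
          latticeConnectedCorr ρ b' L (plaquetteObs ρ 0 1 2) (plaquetteObs ρ 0 1 2) 1 ∧
        latticeConnectedCorr ρ b' L (plaquetteObs ρ 0 1 2) (plaquetteObs ρ 0 1 2) 1 ≤
          (b' / b) ^ 4 * Real.exp (K * (b' - b)) *
            latticeConnectedCorr ρ b L (plaquetteObs ρ 0 1 2) (plaquetteObs ρ 0 1 2) 1 := by
  set m₀ : ℝ := ∫ h, (ρ h).trace.re ∂haarProbability G with hm₀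
  set φ₀ : G → ℝ := fun g => (ρ g).trace.re - m₀ with hφ₀
  set J : ℝ := ((haarConv φ₀)^[5] φ₀) 1 with hJ
  -- `J > 0`
  have hφc : Continuous φ₀ := (continuous_trace_re ρ hρ).sub continuous_const
  have hφs : ∀ g, φ₀ g⁻¹ = φ₀ g := fun g => by
    simp only [hφ₀, Literature.RepresentationTheory.CompactGroups.CompactGroup.re_trace_map_inv ρ hρ]
  have hφ0 : φ₀ ≠ 0 := by
    obtain ⟨g, h, hgh⟩ := hnc
    intro hz
    have h1 := congrFun hz g
    have h2 := congrFun hz h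
    simp only [hφ₀, Pi.zero_apply, sub_eq_zero] at h1 h2
    exact hgh (h1.trans h2.symm)
  have hJpos : 0 < J := convIter_five_apply_one_pos hφc hφs hφ0
  obtain ⟨K₁, K₂, b₀, hb₀, hK₁, hK₂, hest⟩ := cov_facing_deriv_estimate ρ hρ
  set K : ℝ := 2 * (K₂ + 4 * K₁) / J with hKdef
  have hK : 0 ≤ K := by positivity
  refine ⟨min b₀ (J / (2 * (K₁ + 1))), K, by positivity, hK, fun L _ hL b b' hb hbb' hb' => ?_⟩
  set D : ℝ → ℝ := fun x => latticeConnectedCorr ρ x L (plaquetteObs ρ 0 1 2) (plaquetteObs ρ 0 1 2) 1 with hD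
  -- on the window: positivity and a derivative within `(4/x ∓ K)·D x`
  have hwin : ∀ x ∈ Set.Icc b b', ∃ D' : ℝ, HasDerivAt D D' x ∧ 0 < D x ∧
      (4 / x - K) * D x ≤ D' ∧ D' ≤ (4 / x + K) * D x := by
    intro x hx
    have hx0 : 0 < x := lt_of_lt_of_le hb hx.1
    have hxβ : x ≤ min b₀ (J / (2 * (K₁ + 1))) := hx.2.trans hb'
    obtain ⟨hE, D', hD', hE'⟩ := hest L hL x hx0 (hxβ.trans (min_le_left _ _))
    obtain ⟨hDx, hlo, hhi⟩ := slope_law_of_estimates hJpos hK₁ hK₂ hx0 (hxβ.trans (min_le_right _ _)) hE hE'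
    exact ⟨D', hD', lt_of_lt_of_le (by positivity) hDx, hlo, hhi⟩
  -- `φ = log D − 4 log x` has derivative in `[−K, K]` on the window
  set φ : ℝ → ℝ := fun x => Real.log (D x) - 4 * Real.log x with hφ
  have hφd : ∀ x ∈ Set.Icc b b', ∃ φ' : ℝ, HasDerivAt φ φ' x ∧ -K ≤ φ' ∧ φ' ≤ K := by
    intro x hx
    have hx0 : 0 < x := lt_of_lt_of_le hb hx.1
    obtain ⟨D', hD', hDpos, hlo, hhi⟩ := hwin x hx
    refine ⟨D' / D x - 4 * x⁻¹, (hD'.log hDpos.ne').sub ((Real.hasDerivAt_log hx0.ne').const_mul 4), ?_, ?_⟩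
    · -- `D'/D ≥ 4/x − K`
      have h1 : 4 / x - K ≤ D' / D x := by rw [le_div_iff₀ hDpos]; exact hlo
      have h2 : 4 * x⁻¹ = 4 / x := by rw [div_eq_mul_inv]
      linarith
    · have h1 : D' / D x ≤ 4 / x + K := by rw [div_le_iff₀ hDpos]; exact hhi
      have h2 : 4 * x⁻¹ = 4 / x := by rw [div_eq_mul_inv]
      linarith
  have hφc : ContinuousOn φ (Set.Icc b b') := fun x hx => by
    obtain ⟨φ', hφ', -, -⟩ := hφd x hx
    exact hφ'.continuousAt.continuousWithinAt
  have hφdiff : DifferentiableOn ℝ φ (interior (Set.Icc b b')) := by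
    rw [interior_Icc]
    intro x hx
    obtain ⟨φ', hφ', -, -⟩ := hφd x (Set.Ioo_subset_Icc_self hx)
    exact hφ'.differentiableAt.differentiableWithinAt
  have hle : ∀ x ∈ interior (Set.Icc b b'), deriv φ x ≤ K := by
    rw [interior_Icc]
    intro x hx
    obtain ⟨φ', hφ', -, h2⟩ := hφd x (Set.Ioo_subset_Icc_self hx)
    rwa [hφ'.deriv]
  have hge : ∀ x ∈ interior (Set.Icc b b'), -K ≤ deriv φ x := by
    rw [interior_Icc]
    intro x hx
    obtain ⟨φ', hφ', h1, -⟩ := hφd x (Set.Ioo_subset_Icc_self hx)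
    rwa [hφ'.deriv]
  have hbI : b ∈ Set.Icc b b' := ⟨le_rfl, hbb'⟩
  have hb'I : b' ∈ Set.Icc b b' := ⟨hbb', le_rfl⟩
  have hup : φ b' - φ b ≤ K * (b' - b) :=
    (convex_Icc b b').image_sub_le_mul_sub_of_deriv_le hφc hφdiff hle b hbI b' hb'I hbb'
  have hdown : -K * (b' - b) ≤ φ b' - φ b :=
    (convex_Icc b b').mul_sub_le_image_sub_of_le_deriv hφc hφdiff hge b hbI b' hb'I hbb'
  -- exponentiate
  obtain ⟨-, -, hDb, -, -⟩ := hwin b hbI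
  obtain ⟨-, -, hDb', -, -⟩ := hwin b' hb'I
  have hb'0 : 0 < b' := lt_of_lt_of_le hb hbb'
  have hpow : (b' / b) ^ 4 = Real.exp (4 * Real.log b' - 4 * Real.log b) := by
    rw [show 4 * Real.log b' - 4 * Real.log b = ((4 : ℕ) : ℝ) * Real.log (b' / b) by
      rw [Real.log_div hb'0.ne' hb.ne']; push_cast; ring, ← Real.log_pow, Real.exp_log (by positivity)]
  have hφb : φ b = Real.log (D b) - 4 * Real.log b := rfl
  have hφb' : φ b' = Real.log (D b') - 4 * Real.log b' := rfl
  have eDb : Real.exp (Real.log (D b)) = D b := Real.exp_log hDb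
  have eDb' : Real.exp (Real.log (D b')) = D b' := Real.exp_log hDb'
  constructor
  · -- lower: `(b'/b)^4 e^{-K(b'-b)} D b = exp(4 log b' − 4 log b − K(b'−b) + log D b) ≤ exp (log D b')`
    have key : Real.log (D b) + (4 * Real.log b' - 4 * Real.log b) + -(K * (b' - b)) ≤ Real.log (D b') := by
      rw [hφb, hφb'] at hdown; linarith
    calc (b' / b) ^ 4 * Real.exp (-(K * (b' - b))) * D b
        = Real.exp (Real.log (D b) + (4 * Real.log b' - 4 * Real.log b) + -(K * (b' - b))) := by
          rw [Real.exp_add, Real.exp_add, eDb, hpow]; ring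
      _ ≤ Real.exp (Real.log (D b')) := Real.exp_le_exp.2 key
      _ = D b' := eDb'
  · have key : Real.log (D b') ≤ Real.log (D b) + (4 * Real.log b' - 4 * Real.log b) + K * (b' - b) := by
      rw [hφb, hφb'] at hup; linarith
    calc D b' = Real.exp (Real.log (D b')) := eDb'.symm
      _ ≤ Real.exp (Real.log (D b) + (4 * Real.log b' - 4 * Real.log b) + K * (b' - b)) := Real.exp_le_exp.2 key
      _ = (b' / b) ^ 4 * Real.exp (K * (b' - b)) * D b := by
          rw [Real.exp_add, Real.exp_add, eDb, hpow]; ring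

end Summit.QuantumFields.YangMills.Cruxes.IR.SCFloor

end
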